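import Mathlib
import HarnessLib

/-!
# `p`-th root smoothing, base case: `g` submersive
# (crux `IndSmooth.ValuativeSmoothing`, line `birth` r2, support `pthRootSmoothing_of_smooth_aeval`)

Support lemma for crux stmt-ResolutionOfSingularities-16087 (the base case of the open kernel
`stub_pthRootSmoothing`). Setting: `k ⊆ K` fields, `O` a valuation subring of `K`, `T` a
`k`-algebra with a `k`-map `φ : T → K` landing in `O`, `g ∈ T`, and `y ∈ O` with `y ^ p = φ g`.
Hypothesis: `T` is smooth over the polynomial ring `k[X]` through `X ↦ g` (i.e. `g` is
"submersive"). Conclusion: the `p`-th root `y` of `φ g` is realised inside a smooth `k`-algebra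
`T'` through which `φ` factors: there are `ψ : T → T'`, `u ∈ T'`, `χ : T' → K` landing in `O`
with `χ ∘ ψ = φ`, `u ^ p = ψ g`, `χ u = y`.

Proof. Let `U := k[w]` (a polynomial ring in one variable, realised as `MvPolynomial Unit k` to
keep it a different type from `k[X]`), made a `k[X]`-algebra by `X ↦ w ^ p`, and let `T` be a
`k[X]`-algebra by `X ↦ g`. Put `T' := U ⊗[k[X]] T`. Smoothness: `T'` is smooth over `U` by base
change of the smooth `k[X] → T`, and `U` is smooth over `k`, so `T'` is smooth over `k`. Maps:
`ψ t := 1 ⊗ t`, `u := w ⊗ 1`, and `χ` is the `k[X]`-bilinear pairing of `w ↦ y` on `U` with `φ`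
on `T` (both are `k[X]`-linear for the structure `X ↦ y ^ p` on `K`, the second because
`φ g = y ^ p`). Then `u ^ p = w ^ p ⊗ 1 = X • (1 ⊗ 1) = 1 ⊗ g = ψ g`, `χ (ψ t) = φ t`,
`χ u = y`, and `χ` lands in `O` because `χ (a ⊗ b) = a(y) · φ b` with `a(y) ∈ k[y] ⊆ O`.
-/

-- single-problem summit: the doubled namespace component is forced
set_option linter.dupNamespace false

namespace Summit.ResolutionOfSingularities.ResolutionOfSingularities.Theorems.ValuativeSmoothing

open scoped Polynomial TensorProduct

/-- **`p`-th root smoothing, submersive case.** If the `k`-algebra `T` is smooth over `k[X]`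
through `X ↦ g`, `φ : T → K` is a `k`-map into a valuation subring `O` of `K`, and `y ∈ O`
satisfies `y ^ p = φ g`, then `φ` factors as `T → T' → K` through a smooth `k`-algebra `T'`
containing a `p`-th root `u` of (the image of) `g` that is sent to `y`, with `T' → K` still
landing in `O`. (Take `T' := k[w] ⊗[k[X]] T` with `X ↦ w ^ p`.) [folklore] -/
theorem pthRootSmoothing_of_smooth_aeval (p : ℕ) (k K : Type) [Field k] [Field K] [Algebra k K]
    (O : ValuationSubring K) (T : Type) [CommRing T] [Algebra k T] (g : T)
    (hTg : (Polynomial.aeval (R := k) g).toRingHom.Smooth)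
    (φ : T →ₐ[k] K) (hφ : ∀ t : T, φ t ∈ O) (y : K) (hy : y ∈ O) (hyg : y ^ p = φ g) :
    ∃ (T' : Type) (_ : CommRing T') (_ : Algebra k T'), Algebra.Smooth k T' ∧
      ∃ (ψ : T →ₐ[k] T') (u : T') (χ : T' →ₐ[k] K),
        (∀ t : T', χ t ∈ O) ∧ (∀ t : T, χ (ψ t) = φ t) ∧ u ^ p = ψ g ∧ χ u = y := by
  -- `T` as a `k[X]`-algebra through `X ↦ g`; it is smooth over `k[X]` by hypothesis
  letI algXT : Algebra k[X] T := (Polynomial.aeval (R := k) g).toRingHom.toAlgebra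
  haveI towT : IsScalarTower k k[X] T :=
    IsScalarTower.of_algebraMap_eq fun c => ((Polynomial.aeval (R := k) g).commutes c).symm
  haveI smT : Algebra.Smooth k[X] T := hTg
  -- `U := k[w]` as a `k[X]`-algebra through `X ↦ w ^ p`; it is smooth over `k`
  let U : Type := MvPolynomial Unit k
  let w : U := MvPolynomial.X ()
  letI algXU : Algebra k[X] U := (Polynomial.aeval (R := k) (w ^ p)).toRingHom.toAlgebra
  haveI towU : IsScalarTower k k[X] U :=
    IsScalarTower.of_algebraMap_eq fun c => ((Polynomial.aeval (R := k) (w ^ p)).commutes c).symm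
  haveI smU : Algebra.Smooth k U := {}
  -- `K` as a `k[X]`-algebra through `X ↦ y ^ p`
  letI algXK : Algebra k[X] K := (Polynomial.aeval (R := k) (y ^ p)).toRingHom.toAlgebra
  haveI towK : IsScalarTower k k[X] K :=
    IsScalarTower.of_algebraMap_eq fun c => ((Polynomial.aeval (R := k) (y ^ p)).commutes c).symm
  -- the smooth `k`-algebra `T' := U ⊗[k[X]] T`
  haveI smT' : Algebra.Smooth k (U ⊗[k[X]] T) := Algebra.Smooth.comp k U (U ⊗[k[X]] T)
  -- the maps
  let ψ : T →ₐ[k] U ⊗[k[X]] T :=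
    (Algebra.TensorProduct.includeRight : T →ₐ[k[X]] U ⊗[k[X]] T).restrictScalars k
  let f : U →ₐ[k[X]] K :=
    { toRingHom := (MvPolynomial.aeval fun _ : Unit => y).toRingHom
      commutes' := fun q => by
        change MvPolynomial.aeval (fun _ : Unit => y) (Polynomial.aeval (R := k) (w ^ p) q) =
          Polynomial.aeval (R := k) (y ^ p) q
        rw [← Polynomial.aeval_algHom_apply, map_pow, MvPolynomial.aeval_X] }
  have hf : ∀ a : U, f a = MvPolynomial.aeval (fun _ : Unit => y) a := fun a => rfl
  let g' : T →ₐ[k[X]] K :=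
    { toRingHom := φ.toRingHom
      commutes' := fun q => by
        change φ (Polynomial.aeval (R := k) g q) = Polynomial.aeval (R := k) (y ^ p) q
        rw [← Polynomial.aeval_algHom_apply, ← hyg] }
  have hg' : ∀ b : T, g' b = φ b := fun b => rfl
  have hfg : ∀ (a : U) (b : T), Commute (f a) (g' b) := fun _ _ => Commute.all _ _
  let χ : U ⊗[k[X]] T →ₐ[k] K := (Algebra.TensorProduct.lift f g' hfg).restrictScalars k
  have hχ : ∀ (a : U) (b : T), χ (a ⊗ₜ[k[X]] b) = MvPolynomial.aeval (fun _ : Unit => y) a * φ b :=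
    fun a b => by
    change Algebra.TensorProduct.lift f g' hfg (a ⊗ₜ[k[X]] b) = _
    rw [Algebra.TensorProduct.lift_tmul, hf, hg']
  -- values of polynomials at `y` lie in `O`
  have hfO : ∀ a : U, MvPolynomial.aeval (fun _ : Unit => y) a ∈ O := by
    intro a
    induction a using MvPolynomial.induction_on with
    | C c => rw [MvPolynomial.aeval_C, ← φ.commutes c]; exact hφ _
    | add a b ha hb => rw [map_add]; exact add_mem ha hb
    | mul_X a i ha => rw [map_mul, MvPolynomial.aeval_X]; exact mul_mem ha hy
  refine ⟨U ⊗[k[X]] T, inferInstance, inferInstance, smT', ψ, w ⊗ₜ[k[X]] 1, χ, ?_, ?_, ?_, ?_⟩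
  · -- `χ` lands in `O`
    intro t
    induction t with
    | zero => rw [map_zero]; exact zero_mem O
    | tmul a b => rw [hχ]; exact mul_mem (hfO a) (hφ b)
    | add a b ha hb => rw [map_add]; exact add_mem ha hb
  · -- `χ ∘ ψ = φ`
    intro t
    change χ ((1 : U) ⊗ₜ[k[X]] t) = φ t
    rw [hχ, map_one, one_mul]
  · -- `u ^ p = ψ g`: `w ^ p ⊗ 1 = X • (1 ⊗ 1) = 1 ⊗ g`
    change (w ⊗ₜ[k[X]] (1 : T)) ^ p = (1 : U) ⊗ₜ[k[X]] g
    have hwp : w ^ p = algebraMap k[X] U Polynomial.X := (Polynomial.aeval_X (R := k) (w ^ p)).symm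
    have hg : algebraMap k[X] T Polynomial.X = g := Polynomial.aeval_X (R := k) g
    rw [Algebra.TensorProduct.tmul_pow, one_pow, hwp, Algebra.algebraMap_eq_smul_one,
      TensorProduct.smul_tmul, ← Algebra.algebraMap_eq_smul_one, hg]
  · -- `χ u = y`
    rw [hχ, map_one, mul_one]
    exact MvPolynomial.aeval_X _ _

end Summit.ResolutionOfSingularities.ResolutionOfSingularities.Theorems.ValuativeSmoothing
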